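import Literature.Analysis.FluidPDE.AgeDecouplingWindows
import HarnessLib

/-!
# Grid age decoupling, VI: running integrals of the discretisation slack (real-variable toolkit)

Analysis/FluidPDE proof-support file (everything proved). The slack `b` of the grid form of the
window inequality (H2) of the age-decoupling argument (`FluidPDE/AgeDecouplingInequality`) is a sum
of backward windows of nonnegative locally integrable functions,

  `SL(t) = ∫_{t-S}^{t-S+δ} f₁ + ∫_{t-δ}^t f₁ + δ ∫_{t-S}^t f₂ + c₁ + c₂ ∫_{t-S}^t f₃`,

patched near `t = S` by an integrable nonnegative `g` on `(S, S+δ]`: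
`b = 1_{(S,S+δ]} g + 1_{(S,∞)} SL`. This file supplies the real-variable bookkeeping that makes its
running means `O(δ)`: the integrated short windows `∫_S^T ∫_{t-δ}^t f ≤ δ∫₀ᵀ f` and
`∫_S^T ∫_{t-S}^{t-S+δ} f ≤ δ∫₀ᵀ f` (`integral_short_window_le`, `integral_shift_window_le`, by the
Fubini-free `integral_window_le` after a translation), continuity of the shifted window
(`continuousOn_shift_window`), nonnegativity/continuity/the linear bound
`∫_S^T SL ≤ δ(2∫₀ᵀ f₁ + S∫₀ᵀ f₂) + c₁(T - S) + c₂ S ∫₀ᵀ f₃` (`slack_nonneg`, `continuousOn_slack`,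
`integral_slack_le`), and the patched slack `b ≥ 0`, integrable on every `(0, T]`, with
`∫_{(0,T]} b = ∫_{(S,S+δ]} g + ∫_S^T SL` for `T ≥ S + δ` (`patchedSlack_nonneg`,
`integrableOn_patchedSlack`, `setIntegral_patchedSlack_eq`). No single printed source: standard real
analysis. [folklore]
-/

noncomputable section

open _root_.MeasureTheory _root_.Set _root_.Filter
open scoped _root_.Topology

namespace Literature.Analysis.FluidPDE

namespace AgeDecoupling

/-! ## Integrated short windows -/

section ShortWindows

variable {f : ℝ → ℝ}

/-- **Integrated short backward windows**: `∫_S^T ∫_{t-δ}^t f ≤ δ ∫₀ᵀ f` for `f ≥ 0`,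
`0 ≤ δ ≤ S ≤ T`. [folklore] -/
theorem integral_short_window_le (hf : ∀ T, IntegrableOn f (Ioc 0 T)) (hf0 : ∀ t, 0 ≤ f t) {δ S T : ℝ}
    (hδ : 0 ≤ δ) (hδS : δ ≤ S) (hST : S ≤ T) :
    ∫ t in S..T, (∫ s in (t - δ)..t, f s) ≤ δ * ∫ s in (0 : ℝ)..T, f s := by
  have h1 : ∫ t in S..T, (∫ s in (t - δ)..t, f s) ≤ ∫ t in δ..T, (∫ s in (t - δ)..t, f s) :=
    intervalIntegral.integral_mono_interval hδS hST le_rfl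
      (ae_of_all _ fun t => intervalIntegral.integral_nonneg (by linarith) fun s _ => hf0 s)
      (intervalIntegrable_window hf hδ (hδS.trans hST))
  exact h1.trans (integral_window_le hf hf0 hδ (hδS.trans hST))

/-- **Integrated shifted short windows**: `∫_S^T ∫_{t-S}^{t-S+δ} f ≤ δ ∫₀ᵀ f` for `f ≥ 0`,
`0 ≤ δ ≤ S ≤ T` (translate `t ↦ t - (S - δ)` and use `integral_window_le`). [folklore] -/
theorem integral_shift_window_le (hf : ∀ T, IntegrableOn f (Ioc 0 T)) (hf0 : ∀ t, 0 ≤ f t) {δ S T : ℝ}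
    (hδ : 0 ≤ δ) (hδS : δ ≤ S) (hST : S ≤ T) :
    ∫ t in S..T, (∫ s in (t - S)..(t - S + δ), f s) ≤ δ * ∫ s in (0 : ℝ)..T, f s := by
  have e1 : (fun t => ∫ s in (t - S)..(t - S + δ), f s) = fun t => (fun t' => ∫ s in (t' - δ)..t', f s) (t - (S - δ)) := by
    funext t
    simp only
    rw [show t - (S - δ) - δ = t - S by ring, show t - (S - δ) = t - S + δ by ring]
  rw [e1, intervalIntegral.integral_comp_sub_right (fun t' => ∫ s in (t' - δ)..t', f s) (S - δ), sub_sub_cancel]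
  have hT' : δ ≤ T - (S - δ) := by linarith
  calc ∫ t in δ..(T - (S - δ)), (∫ s in (t - δ)..t, f s) ≤ δ * ∫ s in (0 : ℝ)..(T - (S - δ)), f s :=
        integral_window_le hf hf0 hδ hT'
    _ ≤ δ * ∫ s in (0 : ℝ)..T, f s := by
        refine mul_le_mul_of_nonneg_left ?_ hδ
        exact intervalIntegral.integral_mono_interval le_rfl (by linarith) (by linarith) (ae_of_all _ hf0)
          (intervalIntegrable_of_forall_integrableOn hf le_rfl (by linarith))

/-- The shifted short window `t ↦ ∫_{t-S}^{t-S+δ} f` is continuous on `[S, T]` (`0 ≤ δ ≤ S`): it is the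
difference of the backward windows of lengths `S` and `S - δ`. [folklore] -/
theorem continuousOn_shift_window (hf : ∀ T, IntegrableOn f (Ioc 0 T)) {δ S : ℝ} (hδ : 0 ≤ δ) (hδS : δ ≤ S) (T : ℝ) :
    ContinuousOn (fun t => ∫ s in (t - S)..(t - S + δ), f s) (Icc S T) := by
  have h1 := continuousOn_window hf (S := S) (hδ.trans hδS) T
  have h2 := (continuousOn_window hf (S := S - δ) (by linarith) T).mono (Icc_subset_Icc_left (by linarith))
  refine (h1.sub h2).congr fun t ht => ?_
  have i1 : IntervalIntegrable f volume (t - S) (t - (S - δ)) :=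
    intervalIntegrable_of_forall_integrableOn hf (by linarith [ht.1]) (by linarith [ht.1])
  have i2 : IntervalIntegrable f volume (t - (S - δ)) t :=
    intervalIntegrable_of_forall_integrableOn hf (by linarith [ht.1]) (by linarith [ht.1])
  simp only [Pi.sub_apply]
  rw [← intervalIntegral.integral_add_adjacent_intervals i1 i2, show t - (S - δ) = t - S + δ by ring]
  ring

end ShortWindows

/-! ## The slack: nonnegativity, continuity, integrated bound -/

section Slack

variable {f₁ f₂ f₃ : ℝ → ℝ} {δ S c₁ c₂ : ℝ}

/-- The slack is nonnegative (`f₁, f₂, f₃ ≥ 0`, `δ, c₁, c₂ ≥ 0`; windows over ordered intervals). [folklore] -/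
theorem slack_nonneg (h10 : ∀ t, 0 ≤ f₁ t) (h20 : ∀ t, 0 ≤ f₂ t) (h30 : ∀ t, 0 ≤ f₃ t)
    (hδ : 0 ≤ δ) (hS : 0 ≤ S) (hc₁ : 0 ≤ c₁) (hc₂ : 0 ≤ c₂) (t : ℝ) :
    0 ≤ ((∫ s in (t - S)..(t - S + δ), f₁ s) + ∫ s in (t - δ)..t, f₁ s) + δ * (∫ s in (t - S)..t, f₂ s) + c₁ +
      c₂ * ∫ s in (t - S)..t, f₃ s := by
  have i1 : 0 ≤ ∫ s in (t - S)..(t - S + δ), f₁ s := intervalIntegral.integral_nonneg (by linarith) fun s _ => h10 s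
  have i2 : 0 ≤ ∫ s in (t - δ)..t, f₁ s := intervalIntegral.integral_nonneg (by linarith) fun s _ => h10 s
  have i3 : 0 ≤ ∫ s in (t - S)..t, f₂ s := intervalIntegral.integral_nonneg (by linarith) fun s _ => h20 s
  have i4 : 0 ≤ ∫ s in (t - S)..t, f₃ s := intervalIntegral.integral_nonneg (by linarith) fun s _ => h30 s
  positivity

/-- The slack is continuous on `[S, T]` (`0 ≤ δ ≤ S`). [folklore] -/
theorem continuousOn_slack (h1 : ∀ T, IntegrableOn f₁ (Ioc 0 T)) (h2 : ∀ T, IntegrableOn f₂ (Ioc 0 T))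
    (h3 : ∀ T, IntegrableOn f₃ (Ioc 0 T)) (hδ : 0 ≤ δ) (hδS : δ ≤ S) (T : ℝ) :
    ContinuousOn (fun t => ((∫ s in (t - S)..(t - S + δ), f₁ s) + ∫ s in (t - δ)..t, f₁ s) + δ * (∫ s in (t - S)..t, f₂ s) + c₁ +
      c₂ * ∫ s in (t - S)..t, f₃ s) (Icc S T) := by
  have hS : 0 ≤ S := hδ.trans hδS
  have w1 := continuousOn_shift_window h1 hδ hδS T
  have w2 := (continuousOn_window h1 (S := δ) hδ T).mono (Icc_subset_Icc_left hδS)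
  have w3 := continuousOn_window h2 (S := S) hS T
  have w4 := continuousOn_window h3 (S := S) hS T
  exact ((((w1.add w2).add (continuousOn_const.mul w3)).add continuousOn_const).add (continuousOn_const.mul w4))

/-- **The integrated slack is linear in the budgets**: for `0 ≤ δ ≤ S ≤ T`, `f₁, f₂, f₃ ≥ 0` integrable
on every `(0, T']` and `c₂ ≥ 0`,
`∫_S^T SL ≤ δ (2∫₀ᵀ f₁ + S ∫₀ᵀ f₂) + c₁ (T - S) + c₂ S ∫₀ᵀ f₃`. [folklore] -/
theorem integral_slack_le (h1 : ∀ T, IntegrableOn f₁ (Ioc 0 T)) (h2 : ∀ T, IntegrableOn f₂ (Ioc 0 T))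
    (h3 : ∀ T, IntegrableOn f₃ (Ioc 0 T)) (h10 : ∀ t, 0 ≤ f₁ t) (h20 : ∀ t, 0 ≤ f₂ t) (h30 : ∀ t, 0 ≤ f₃ t)
    (hδ : 0 ≤ δ) (hδS : δ ≤ S) (hc₂ : 0 ≤ c₂) {T : ℝ} (hST : S ≤ T) :
    ∫ t in S..T, (((∫ s in (t - S)..(t - S + δ), f₁ s) + ∫ s in (t - δ)..t, f₁ s) + δ * (∫ s in (t - S)..t, f₂ s) + c₁ +
        c₂ * ∫ s in (t - S)..t, f₃ s) ≤
      δ * (2 * (∫ s in (0 : ℝ)..T, f₁ s) + S * ∫ s in (0 : ℝ)..T, f₂ s) + c₁ * (T - S) + c₂ * (S * ∫ s in (0 : ℝ)..T, f₃ s) := by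
  have hS : 0 ≤ S := hδ.trans hδS
  -- interval integrability of the five pieces on `[S, T]`
  have hST' : uIcc S T = Icc S T := uIcc_of_le hST
  have i1 : IntervalIntegrable (fun t => ∫ s in (t - S)..(t - S + δ), f₁ s) volume S T :=
    ContinuousOn.intervalIntegrable (by rw [hST']; exact continuousOn_shift_window h1 hδ hδS T)
  have i2 : IntervalIntegrable (fun t => ∫ s in (t - δ)..t, f₁ s) volume S T :=
    ContinuousOn.intervalIntegrable (by rw [hST']; exact (continuousOn_window h1 (S := δ) hδ T).mono (Icc_subset_Icc_left hδS))
  have i3 : IntervalIntegrable (fun t => ∫ s in (t - S)..t, f₂ s) volume S T := intervalIntegrable_window h2 hS hST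
  have i4 : IntervalIntegrable (fun t => ∫ s in (t - S)..t, f₃ s) volume S T := intervalIntegrable_window h3 hS hST
  -- split the integral
  rw [intervalIntegral.integral_add (((i1.add i2).add (i3.const_mul δ)).add intervalIntegrable_const) (i4.const_mul c₂),
    intervalIntegral.integral_add ((i1.add i2).add (i3.const_mul δ)) intervalIntegrable_const,
    intervalIntegral.integral_add (i1.add i2) (i3.const_mul δ), intervalIntegral.integral_add i1 i2,
    intervalIntegral.integral_const_mul, intervalIntegral.integral_const_mul, intervalIntegral.integral_const, smul_eq_mul]
  -- the four bounds
  have b1 := integral_shift_window_le h1 h10 hδ hδS hST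
  have b2 := integral_short_window_le h1 h10 hδ hδS hST
  have b3 := integral_window_le h2 h20 hS hST
  have b4 := integral_window_le h3 h30 hS hST
  have b3' := mul_le_mul_of_nonneg_left b3 hδ
  have b4' := mul_le_mul_of_nonneg_left b4 hc₂
  have hsum := add_le_add (add_le_add (add_le_add (add_le_add b1 b2) b3') (le_of_eq (mul_comm (T - S) c₁))) b4'
  refine hsum.trans (le_of_eq ?_)
  ring

end Slack

/-! ## The patched slack -/

section Patched

variable {g SL : ℝ → ℝ} {δ S : ℝ}

/-- The patched slack `1_{(S,S+δ]} g + 1_{(S,∞)} SL` is nonnegative for `g, SL ≥ 0`. [folklore] -/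
theorem patchedSlack_nonneg (hg0 : ∀ t, 0 ≤ g t) (hSL0 : ∀ t, 0 ≤ SL t) (t : ℝ) :
    0 ≤ (Ioc S (S + δ)).indicator g t + (Ioi S).indicator SL t :=
  add_nonneg (Set.indicator_nonneg (fun s _ => hg0 s) t) (Set.indicator_nonneg (fun s _ => hSL0 s) t)

/-- The patched slack is integrable on every `(0, T]` (`g` integrable on `(S, S+δ]`, `SL` continuous on
every `[S, T]`). [folklore] -/
theorem integrableOn_patchedSlack (hgi : IntegrableOn g (Ioc S (S + δ)))
    (hSLc : ∀ T, ContinuousOn SL (Icc S T)) (T : ℝ) :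
    IntegrableOn (fun t => (Ioc S (S + δ)).indicator g t + (Ioi S).indicator SL t) (Ioc 0 T) := by
  refine IntegrableOn.add ?_ ?_
  · rw [IntegrableOn, integrable_indicator_iff measurableSet_Ioc]
    exact hgi.mono_measure Measure.restrict_le_self
  · rw [IntegrableOn, integrable_indicator_iff measurableSet_Ioi, IntegrableOn, Measure.restrict_restrict measurableSet_Ioi]
    have hsub : Ioi S ∩ Ioc 0 T ⊆ Icc S T := fun t ht => ⟨ht.1.le, ht.2.2⟩
    exact ((hSLc T).integrableOn_Icc).mono_set hsub

/-- **The running integral of the patched slack**: for `S ≥ 0` and `T ≥ S + δ`, `δ ≥ 0`,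
`∫_{(0,T]} b = ∫_{(S,S+δ]} g + ∫_S^T SL`. [folklore] -/
theorem setIntegral_patchedSlack_eq (hS : 0 ≤ S) (hδ : 0 ≤ δ) (hgi : IntegrableOn g (Ioc S (S + δ)))
    (hSLc : ∀ T, ContinuousOn SL (Icc S T)) {T : ℝ} (hT : S + δ ≤ T) :
    ∫ t in Ioc 0 T, ((Ioc S (S + δ)).indicator g t + (Ioi S).indicator SL t) =
      (∫ t in Ioc S (S + δ), g t) + ∫ t in S..T, SL t := by
  have hi1 : IntegrableOn (fun t => (Ioc S (S + δ)).indicator g t) (Ioc 0 T) := by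
    rw [IntegrableOn, integrable_indicator_iff measurableSet_Ioc]
    exact hgi.mono_measure Measure.restrict_le_self
  have hi2 : IntegrableOn (fun t => (Ioi S).indicator SL t) (Ioc 0 T) := by
    rw [IntegrableOn, integrable_indicator_iff measurableSet_Ioi, IntegrableOn, Measure.restrict_restrict measurableSet_Ioi]
    have hsub : Ioi S ∩ Ioc 0 T ⊆ Icc S T := fun t ht => ⟨ht.1.le, ht.2.2⟩
    exact ((hSLc T).integrableOn_Icc).mono_set hsub
  rw [integral_add hi1 hi2, setIntegral_indicator measurableSet_Ioc, setIntegral_indicator measurableSet_Ioi]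
  have e1 : Ioc 0 T ∩ Ioc S (S + δ) = Ioc S (S + δ) := by
    rw [Ioc_inter_Ioc, max_eq_right hS, min_eq_right hT]
  have e2 : Ioc 0 T ∩ Ioi S = Ioc S T := by
    ext t; simp only [mem_inter_iff, mem_Ioc, mem_Ioi]
    constructor
    · rintro ⟨⟨-, h2⟩, h3⟩; exact ⟨h3, h2⟩
    · rintro ⟨h1, h2⟩; exact ⟨⟨hS.trans_lt h1, h2⟩, h1⟩
  rw [e1, e2, intervalIntegral.integral_of_le (by linarith)]

end Patched

end AgeDecoupling

end Literature.Analysis.FluidPDE
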